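import Literature.Analysis.FluidPDE.PassiveVectorUniqueness
import Literature.Analysis.FluidPDE.PassiveVectorLionsExistence
import Literature.Analysis.FluidPDE.PassiveVectorEnergyEquality
import Literature.Analysis.FluidPDE.LagrangianLatticeCarrier
import Literature.Analysis.FluidPDE.DoeringFoiasPowerProofs
import Literature.Analysis.FunctionSpaces.TorusSobolevNormProofs
import HarnessLib

/-!
# Renormalisation bound ⇒ rung leaf, for an ARBITRARY carrier: the route-independent core of
# `CascadeBookkeeping` (route `SolenoidalFractalHomogenisation`, support item stmt-AnomalousDissipation-19074;
# seat ad-solenoidal-cb-p1, cell ad-ideate)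

ROUTE-INDEPENDENT FILE (no `Theses` import — so the route file itself may import it and glue through it).
The landed composition `CascadeBookkeeping.cascadeBookkeeping_of_exists_of_lowerEnergy` (…Composition, p528227) is
phrased over `LatticeShear.FractalCarrierData`, takes A0 weak existence (V1) and the lower energy inequality (V2) as
hypotheses and concludes the route decl `CascadeBookkeeping`. Both hypotheses are now Literature theorems
(`Torus.exists_isWeakPassiveVectorOn`, Lions' method; `IsWeakPassiveVectorOn.ae_lower_energy_ineq`, energy equality),
so this file records the UNCONDITIONAL statement with the carrier abstracted away and without the route import:
* `rate_of_renormalisationBound` — for `α > 0`, a `C⁰_t C^{0,α}_x` carrier `b` weakly divergence free at every time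
  and viscosities `ν_j > 0`, the renormalisation-type hypothesis (VERBATIM the shape of
  `FractalCarrierData.RenormalisationBound` / `LagrangianLatticeCarrier.RenormalisationBound` with `kbar ↦ ν`,
  `carrier ↦ b`: for every class `R` an energy fraction `η(R) > 0` of every A0 weak solution from an `H¹` mean-zero
  divergence-free datum of class `R` is gone for a.e. `t ∈ (½,1)`, uniformly in `j ≥ j₀(R)`) gives for every `R` a rate
  `c(R) = min (η'/2) (4π²m/(1+8π²m)) > 0` (`η' = min η 1`, `m = min_{j<j₀} ν_j`): weak solutions exist and EVERY weak
  solution dissipates `ν_j∫₀¹‖∇w‖² ≥ c(R)‖w₀‖²` (for `j < j₀(R)` by Poincaré decay of the mean-zero slices);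
* `leaf_of_renormalisationBound` — with `b` time-periodic and `ν_j → 0`, the `∃ α b ν …` statement that is LITERALLY
  the body of the route's leaf `Theses.SolenoidalFractalHomogenisation.Target` (`exact` closes `Target` by unfolding);
* instances `leaf_of_fractalCarrierData` (Eulerian fractal carrier; of `Permissible` only `kbar → 0` is used) and
  `leaf_of_lagrangianLatticeCarrier` (`LagrangianLatticeCarrier`, p547300: `LPermissible → Regular →
  RenormalisationBound → leaf` — the bookkeeping support of the Lagrangian re-typing, cell ad-ideate ROUND-15 §C.2).
The private lemmas of §1–§2 are verbatim copies of the public ones in namespace `…CascadeBookkeeping` of the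
Composition file (which imports the route file and so cannot be imported here). Honest framing: rung-leaf bookkeeping
on F-D1 (route 1) only — "renormalisation bound ⇒ leaf"; nothing about anomalous dissipation in general is claimed.
-/

set_option linter.dupNamespace false

noncomputable section

namespace Summit.AnomalousDissipation.AnomalousDissipation.Theorems.SolenoidalFractalHomogenisation.CascadeBookkeepingCore

open Set Filter Topology MeasureTheory Function
open scoped InnerProductSpace ENNReal NNReal
open Literature.Analysis Literature.Analysis.FunctionSpaces Literature.Analysis.FunctionSpaces.Torus
open Literature.Analysis.FluidPDE Literature.Analysis.FluidPDE.Torus Literature.Analysis.FluidPDE.LatticeShear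

/-! ## Carrier bookkeeping: `C⁰_t C^{0,α}_x` carriers are jointly continuous and bounded on `[0,T]` -/

/-- A `C⁰_t C^{0,α}_x` family (`α > 0`) on all of `ℝ` is jointly continuous on `ℝ × T³`. [folklore] -/
private theorem continuous_uncurry_of_continuousInHolderOn {α : ℝ≥0} (hα : 0 < α)
    {b : ℝ → UnitAddTorus (Fin 3) → EuclideanSpace ℝ (Fin 3)} (hb : ContinuousInHolderOn univ α b) :
    Continuous (uncurry b) := by
  rw [continuous_iff_continuousAt]
  rintro ⟨t₀, x₀⟩
  have hslice : Continuous (b t₀) := (hb.1 t₀ (mem_univ _)).continuous hα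
  have h1 : Tendsto (fun p : ℝ × UnitAddTorus (Fin 3) => eBoundedHolderNorm α (b p.1 - b t₀)) (𝓝 (t₀, x₀)) (𝓝 0) := by
    have h := hb.2 t₀ (mem_univ _)
    rw [nhdsWithin_univ] at h
    exact h.comp (continuous_fst.tendsto (t₀, x₀))
  have h2 : Tendsto (fun p : ℝ × UnitAddTorus (Fin 3) => ‖b t₀ p.2 - b t₀ x₀‖ₑ) (𝓝 (t₀, x₀)) (𝓝 0) := by
    have hc : Continuous fun p : ℝ × UnitAddTorus (Fin 3) => b t₀ p.2 - b t₀ x₀ :=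
      (hslice.comp continuous_snd).sub continuous_const
    have := hc.enorm.tendsto (t₀, x₀)
    simpa using this
  have h12 : Tendsto (fun p : ℝ × UnitAddTorus (Fin 3) =>
      eBoundedHolderNorm α (b p.1 - b t₀) + ‖b t₀ p.2 - b t₀ x₀‖ₑ) (𝓝 (t₀, x₀)) (𝓝 0) := by
    simpa using h1.add h2
  rw [ContinuousAt, tendsto_iff_edist_tendsto_0]
  refine tendsto_of_tendsto_of_tendsto_of_le_of_le tendsto_const_nhds h12 (fun p => zero_le) (fun p => ?_)
  calc edist (uncurry b p) (uncurry b (t₀, x₀)) = ‖(b p.1 - b t₀) p.2 + (b t₀ p.2 - b t₀ x₀)‖ₑ := by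
        rw [edist_eq_enorm_sub]
        congr 1
        simp only [uncurry, Pi.sub_apply]
        abel
    _ ≤ ‖(b p.1 - b t₀) p.2‖ₑ + ‖b t₀ p.2 - b t₀ x₀‖ₑ := enorm_add_le _ _
    _ ≤ eBoundedHolderNorm α (b p.1 - b t₀) + ‖b t₀ p.2 - b t₀ x₀‖ₑ := by
        gcongr
        exact (enorm_le_eSupNorm _ _).trans (eSupNorm_le_eBoundedHolderNorm _ _)

/-- Restriction of `C⁰_t C^{0,α}_x` to a smaller time set. [folklore] -/
private theorem continuousInHolderOn_mono {α : ℝ≥0} {S S' : Set ℝ} (hS : S' ⊆ S)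
    {b : ℝ → UnitAddTorus (Fin 3) → EuclideanSpace ℝ (Fin 3)} (hb : ContinuousInHolderOn S α b) :
    ContinuousInHolderOn S' α b :=
  ⟨fun t ht => hb.1 t (hS ht), fun t₀ ht₀ => (hb.2 t₀ (hS ht₀)).mono_left (nhdsWithin_mono _ hS)⟩

/-- A `C⁰_t C^{0,α}_x` family on all of `ℝ` is uniformly bounded on `[0,T] × T³`. [folklore] -/
private theorem exists_norm_le_of_continuousInHolderOn {α : ℝ≥0}
    {b : ℝ → UnitAddTorus (Fin 3) → EuclideanSpace ℝ (Fin 3)} (hb : ContinuousInHolderOn univ α b) (T : ℝ) :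
    ∃ C : ℝ, ∀ t ∈ Icc 0 T, ∀ x, ‖b t x‖ ≤ C := by
  have hU : HolderUniformlyBoundedOn (Icc 0 T) α b :=
    ContinuousInHolderOn.holderUniformlyBoundedOn_holds (continuousInHolderOn_mono (subset_univ _) hb) isCompact_Icc
  set M : ℝ≥0∞ := ⨆ t ∈ Icc 0 T, eBoundedHolderNorm α (b t) with hM
  have hMtop : M < ∞ := hU
  refine ⟨M.toReal, fun t ht x => ?_⟩
  have h : ‖b t x‖ₑ ≤ M :=
    (enorm_le_eSupNorm _ _).trans ((eSupNorm_le_eBoundedHolderNorm α _).trans (le_iSup₂ (f := fun t _ => eBoundedHolderNorm α (b t)) t ht))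
  rw [← ofReal_norm] at h
  exact (ENNReal.ofReal_le_iff_le_toReal hMtop.ne).1 h

/-- The space–time lift of a `C⁰_t C^{0,α}_x` (`α > 0`) carrier is in `L^∞((0,T) × T³)`. [folklore] -/
private theorem memLp_top_stLift_of_continuousInHolderOn {α : ℝ≥0} (hα : 0 < α)
    {b : ℝ → UnitAddTorus (Fin 3) → EuclideanSpace ℝ (Fin 3)} (hb : ContinuousInHolderOn univ α b) (T : ℝ) :
    MemLp (stLift b) ∞ (volume.restrict (Ioo 0 T ×ˢ (univ : Set (EuclideanSpace ℝ (Fin 3))))) := by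
  have hc : Continuous (stLift b) := by
    have e : stLift b = uncurry b ∘ Prod.map id proj := by
      funext ⟨t, y⟩
      rfl
    rw [e]
    exact (continuous_uncurry_of_continuousInHolderOn hα hb).comp (continuous_id.prodMap continuous_proj)
  obtain ⟨C, hC⟩ := exists_norm_le_of_continuousInHolderOn hb T
  refine memLp_top_of_bound hc.aestronglyMeasurable C ?_
  filter_upwards [ae_restrict_mem (measurableSet_Ioo.prod MeasurableSet.univ)] with p hp
  exact hC p.1 (Ioo_subset_Icc_self hp.1) (proj p.2)

/-- `w₀ ∈ H¹` (spectrally, through the complexification) implies `w₀ ∈ L²(T³; ℝ³)`. [folklore] -/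
private theorem memLp_two_of_memSobolev_complexify {w₀ : UnitAddTorus (Fin 3) → EuclideanSpace ℝ (Fin 3)} {s : ℝ}
    (hs : 0 ≤ s) (h : MemSobolev s (EuclideanSpace.complexify ∘ w₀)) : MemLp w₀ 2 volume := by
  have h2 : MemLp (EuclideanSpace.complexify ∘ w₀) 2 volume := MemSobolev.memLp_two_holds h hs
  have hm : AEStronglyMeasurable w₀ volume :=
    (EuclideanSpace.complexify (ι := Fin 3)).isometry.isEmbedding.aestronglyMeasurable_comp_iff.1 h2.1
  refine h2.of_le hm (ae_of_all _ fun x => ?_)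
  simp only [Function.comp_apply, EuclideanSpace.norm_complexify, le_refl]

open UnitAddTorus in
/-- **The mean of a weak passive-vector solution is conserved**: for a weak solution with integrable mean-zero
datum, `∫ w(t) = 0` for a.e. `t ∈ (0,1)` (the `k = 0` instance of the modewise identity
`IsWeakPassiveVectorOn.ae_inner_mFourierCoeff_eq`: the zero mode sees neither transport nor diffusion).
[cite: DiPernaLions1989, §II.1 (13)–(14)] -/
private theorem ae_hasZeroMean {ν : ℝ} {b w : ℝ → UnitAddTorus (Fin 3) → EuclideanSpace ℝ (Fin 3)}
    {w₀ : UnitAddTorus (Fin 3) → EuclideanSpace ℝ (Fin 3)} (h : IsWeakPassiveVectorOn 0 1 ν b w₀ w)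
    (hw₀ : Integrable w₀ volume) (h0 : HasZeroMean w₀) :
    ∀ᵐ t ∂(volume.restrict (Ioo 0 1)), HasZeroMean (w t) := by
  have hz : ∀ i : Fin 3, ∑ j, ((0 : Fin 3 → ℤ) j : ℂ) *
      (EuclideanSpace.single i (1 : ℂ) : EuclideanSpace ℂ (Fin 3)) j = 0 := fun i => by simp
  have hall : ∀ i : Fin 3, ∀ᵐ t ∂(volume.restrict (Ioo 0 1)),
      ⟪mFourierCoeff (EuclideanSpace.complexify ∘ w t) 0, EuclideanSpace.single i (1 : ℂ)⟫_ℂ =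
        ⟪mFourierCoeff (EuclideanSpace.complexify ∘ w₀) 0, EuclideanSpace.single i (1 : ℂ)⟫_ℂ := by
    intro i
    filter_upwards [h.ae_inner_mFourierCoeff_eq hw₀ 0 (hz i)] with t ht
    rw [ht]
    simp [FunctionSpaces.Torus.freqNormSq]
  rw [← ae_all_iff] at hall
  filter_upwards [hall] with t ht
  have h0' : mFourierCoeff (EuclideanSpace.complexify ∘ w₀) 0 = 0 := by
    rw [mFourierCoeff_complexify_zero, show (∫ x, w₀ x) = 0 from h0, map_zero]
  have hv : mFourierCoeff (EuclideanSpace.complexify ∘ w t) 0 = 0 := by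
    ext i
    have hi := ht i
    rw [h0', inner_zero_left, EuclideanSpace.inner_single_right] at hi
    simpa using hi
  rw [mFourierCoeff_complexify_zero] at hv
  exact EuclideanSpace.complexify_injective (by rw [hv, map_zero])

/-- **Poincaré bookkeeping at one fixed viscosity.** If a time-dependent field `w` on `(0,1)` has `L²`, mean-zero
slices and satisfies the lower energy inequality `A ≤ ‖w(t)‖² + 2ν∫₀ᵗ‖∇w‖²` for a.e. `t` (in `[0,∞]`), then
`ν ∫₀¹ ‖∇w‖² ≥ 4π²ν/(1+8π²ν) · A`: the spectral Poincaré inequality `4π²‖w(t)‖² ≤ ‖∇w(t)‖²` on mean-zero slices,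
integrated over `(0,1)`. [folklore] -/
private theorem dissipation_ge_of_hasZeroMean {ν : ℝ} (hν : 0 < ν)
    {w : ℝ → UnitAddTorus (Fin 3) → EuclideanSpace ℝ (Fin 3)} {A : ℝ}
    (hmem : ∀ᵐ t ∂(volume.restrict (Ioo 0 1)), MemLp (w t) 2 volume)
    (hmean : ∀ᵐ t ∂(volume.restrict (Ioo 0 1)), HasZeroMean (w t))
    (hE : ∀ᵐ t ∂(volume.restrict (Ioo 0 1)),
      ENNReal.ofReal A ≤ ENNReal.ofReal (vectorL2Sq (w t)) + 2 * eVectorDissipation ν w 0 t) :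
    ENNReal.ofReal (4 * Real.pi ^ 2 * ν / (1 + 8 * Real.pi ^ 2 * ν) * A) ≤ eVectorDissipation ν w 0 1 := by
  set E := eVectorDissipation ν w 0 1 with hEdef
  set G : ℝ → ℝ≥0∞ := fun t => eGradNormSq (w t) with hG
  have hEG : E = ENNReal.ofReal ν * ∫⁻ t in Ioo 0 1, G t := rfl
  have hmono : ∀ t ∈ Ioo (0:ℝ) 1, eVectorDissipation ν w 0 t ≤ E := fun t ht => by
    rw [hEdef]
    unfold eVectorDissipation
    exact mul_le_mul_right (lintegral_mono_set (Ioo_subset_Ioo le_rfl ht.2.le)) _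
  have hpt : ∀ᵐ t ∂(volume.restrict (Ioo 0 1)),
      ENNReal.ofReal (4 * Real.pi ^ 2 * A) ≤ G t + ENNReal.ofReal (4 * Real.pi ^ 2) * (2 * E) := by
    filter_upwards [hmem, hmean, hE, ae_restrict_mem measurableSet_Ioo] with t hm h0 hEt ht
    have hP := ofReal_integral_norm_sq_le_eGradNormSq_add hm
    rw [show (∫ x, w t x) = 0 from h0, norm_zero] at hP
    simp only [ne_eq, OfNat.ofNat_ne_zero, not_false_eq_true, zero_pow, mul_zero, ENNReal.ofReal_zero,
      add_zero] at hP
    change ENNReal.ofReal (4 * Real.pi ^ 2 * vectorL2Sq (w t)) ≤ G t at hP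
    have e1 : ENNReal.ofReal (4 * Real.pi ^ 2 * vectorL2Sq (w t)) =
        ENNReal.ofReal (4 * Real.pi ^ 2) * ENNReal.ofReal (vectorL2Sq (w t)) := ENNReal.ofReal_mul (by positivity)
    rw [e1] at hP
    have hEt' : ENNReal.ofReal A ≤ ENNReal.ofReal (vectorL2Sq (w t)) + 2 * E :=
      hEt.trans (add_le_add le_rfl (mul_le_mul_right (hmono t ht) 2))
    calc ENNReal.ofReal (4 * Real.pi ^ 2 * A)
        = ENNReal.ofReal (4 * Real.pi ^ 2) * ENNReal.ofReal A := ENNReal.ofReal_mul (by positivity)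
      _ ≤ ENNReal.ofReal (4 * Real.pi ^ 2) * (ENNReal.ofReal (vectorL2Sq (w t)) + 2 * E) := by gcongr
      _ = ENNReal.ofReal (4 * Real.pi ^ 2) * ENNReal.ofReal (vectorL2Sq (w t)) +
            ENNReal.ofReal (4 * Real.pi ^ 2) * (2 * E) := mul_add _ _ _
      _ ≤ G t + ENNReal.ofReal (4 * Real.pi ^ 2) * (2 * E) := add_le_add hP le_rfl
  have hint : ENNReal.ofReal (4 * Real.pi ^ 2 * A) ≤
      (∫⁻ t in Ioo 0 1, G t) + ENNReal.ofReal (4 * Real.pi ^ 2) * (2 * E) := by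
    have h := lintegral_mono_ae hpt
    rw [lintegral_const, Measure.restrict_apply_univ, Real.volume_Ioo, sub_zero, ENNReal.ofReal_one, mul_one,
      lintegral_add_right _ measurable_const, lintegral_const, Measure.restrict_apply_univ, Real.volume_Ioo,
      sub_zero, ENNReal.ofReal_one, mul_one] at h
    exact h
  -- multiply by `ν`
  have hkey : ENNReal.ofReal (4 * Real.pi ^ 2 * ν * A) ≤ (1 + ENNReal.ofReal (8 * Real.pi ^ 2 * ν)) * E := by
    have h := mul_le_mul_right hint (ENNReal.ofReal ν)
    calc ENNReal.ofReal (4 * Real.pi ^ 2 * ν * A)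
        = ENNReal.ofReal ν * ENNReal.ofReal (4 * Real.pi ^ 2 * A) := by
          rw [← ENNReal.ofReal_mul hν.le]; ring_nf
      _ ≤ ENNReal.ofReal ν * ((∫⁻ t in Ioo 0 1, G t) + ENNReal.ofReal (4 * Real.pi ^ 2) * (2 * E)) := h
      _ = E + ENNReal.ofReal (8 * Real.pi ^ 2 * ν) * E := by
          rw [mul_add, ← hEG, ← mul_assoc, ← mul_assoc, ← ENNReal.ofReal_mul hν.le, ← ENNReal.ofReal_ofNat 2,
            ← ENNReal.ofReal_mul (by positivity)]
          ring_nf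
      _ = (1 + ENNReal.ofReal (8 * Real.pi ^ 2 * ν)) * E := by ring
  -- conclude
  by_cases hEtop : E = ∞
  · rw [hEtop]; exact le_top
  have h1top : (1 + ENNReal.ofReal (8 * Real.pi ^ 2 * ν)) * E ≠ ∞ :=
    ENNReal.mul_ne_top (by simp) hEtop
  have hreal : 4 * Real.pi ^ 2 * ν * A ≤ (1 + 8 * Real.pi ^ 2 * ν) * E.toReal := by
    have h := (ENNReal.ofReal_le_iff_le_toReal h1top).1 hkey
    rwa [ENNReal.toReal_mul, ENNReal.toReal_add (by simp) ENNReal.ofReal_ne_top, ENNReal.toReal_one,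
      ENNReal.toReal_ofReal (by positivity)] at h
  refine (ENNReal.ofReal_le_iff_le_toReal hEtop).2 ?_
  rw [div_mul_eq_mul_div, div_le_iff₀ (by positivity)]
  linarith

/-- **Decay bookkeeping.** If `‖w(t)‖² ≤ (1-η)A` for a.e. `t ∈ (½,1)` (`0 < η ≤ 1`) and the lower energy inequality
`A ≤ ‖w(t)‖² + 2ν∫₀ᵗ‖∇w‖²` holds for a.e. `t ∈ (0,1)`, then `ν∫₀¹‖∇w‖² ≥ (η/2) A`. [folklore] -/
private theorem dissipation_ge_of_decay {ν η A : ℝ} (hη : 0 < η) (hη1 : η ≤ 1) (hA : 0 ≤ A)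
    {w : ℝ → UnitAddTorus (Fin 3) → EuclideanSpace ℝ (Fin 3)}
    (hdecay : ∀ᵐ t ∂(volume.restrict (Ioo (1/2 : ℝ) 1)), vectorL2Sq (w t) ≤ (1 - η) * A)
    (hE : ∀ᵐ t ∂(volume.restrict (Ioo 0 1)),
      ENNReal.ofReal A ≤ ENNReal.ofReal (vectorL2Sq (w t)) + 2 * eVectorDissipation ν w 0 t) :
    ENNReal.ofReal (η / 2 * A) ≤ eVectorDissipation ν w 0 1 := by
  set E := eVectorDissipation ν w 0 1 with hEdef
  have hE' : ∀ᵐ t ∂(volume.restrict (Ioo (1/2 : ℝ) 1)),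
      ENNReal.ofReal A ≤ ENNReal.ofReal (vectorL2Sq (w t)) + 2 * eVectorDissipation ν w 0 t :=
    ae_restrict_of_ae_restrict_of_subset (Ioo_subset_Ioo (by norm_num) le_rfl) hE
  have hne : volume.restrict (Ioo (1/2 : ℝ) 1) ≠ 0 := by
    intro h0
    have h := congrArg (fun μ : Measure ℝ => μ univ) h0
    simp only [Measure.restrict_apply_univ, Real.volume_Ioo, Measure.coe_zero, Pi.zero_apply,
      ENNReal.ofReal_eq_zero] at h
    norm_num at h
  haveI : (ae (volume.restrict (Ioo (1/2 : ℝ) 1))).NeBot := ae_neBot.2 hne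
  obtain ⟨t, hd, hEt, ht⟩ := (hdecay.and (hE'.and (ae_restrict_mem measurableSet_Ioo))).exists
  have hmono : eVectorDissipation ν w 0 t ≤ E := by
    rw [hEdef]
    unfold eVectorDissipation
    exact mul_le_mul_right (lintegral_mono_set (Ioo_subset_Ioo le_rfl ht.2.le)) _
  have h1 : ENNReal.ofReal A ≤ ENNReal.ofReal ((1 - η) * A) + 2 * E :=
    hEt.trans (add_le_add (ENNReal.ofReal_le_ofReal hd) (mul_le_mul_right hmono 2))
  have hsplit : ENNReal.ofReal A = ENNReal.ofReal ((1 - η) * A) + ENNReal.ofReal (η * A) := by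
    rw [← ENNReal.ofReal_add (by nlinarith) (by positivity)]
    ring_nf
  rw [hsplit] at h1
  have h2 : ENNReal.ofReal (η * A) ≤ 2 * E := (ENNReal.add_le_add_iff_left ENNReal.ofReal_ne_top).1 h1
  have h3 : ENNReal.ofReal (η / 2 * A) * 2 ≤ E * 2 := by
    calc ENNReal.ofReal (η / 2 * A) * 2 = ENNReal.ofReal (η / 2 * A) * ENNReal.ofReal 2 := by
          rw [ENNReal.ofReal_ofNat]
      _ = ENNReal.ofReal (η * A) := by rw [← ENNReal.ofReal_mul (by positivity)]; ring_nf
      _ ≤ 2 * E := h2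
      _ = E * 2 := mul_comm _ _
  exact (ENNReal.mul_le_mul_iff_left two_ne_zero ENNReal.ofNat_ne_top).1 h3

/-- For a positive sequence and `j₀`, some `m > 0` lies below `ν_j` for all `j < j₀`. [folklore] -/
private theorem exists_pos_forall_lt_le (ν : ℕ → ℝ) (hν : ∀ j, 0 < ν j) (j₀ : ℕ) :
    ∃ m : ℝ, 0 < m ∧ ∀ j < j₀, m ≤ ν j := by
  induction j₀ with
  | zero => exact ⟨1, one_pos, fun j hj => (Nat.not_lt_zero _ hj).elim⟩
  | succ n ih =>
    obtain ⟨m, hm, h⟩ := ih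
    refine ⟨min m (ν n), lt_min hm (hν n), fun j hj => ?_⟩
    rcases Nat.lt_succ_iff_lt_or_eq.1 hj with hj | rfl
    · exact (min_le_left _ _).trans (h j hj)
    · exact min_le_right _ _

/-- The Poincaré constant `x ↦ 4π²x/(1+8π²x)` is monotone on `(0,∞)`. [folklore] -/
private theorem poincareConst_mono {m x : ℝ} (hm : 0 < m) (hmx : m ≤ x) :
    4 * Real.pi ^ 2 * m / (1 + 8 * Real.pi ^ 2 * m) ≤ 4 * Real.pi ^ 2 * x / (1 + 8 * Real.pi ^ 2 * x) := by
  have hx : 0 < x := hm.trans_le hmx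
  rw [div_le_div_iff₀ (by positivity) (by positivity)]
  nlinarith [Real.pi_pos, pow_pos Real.pi_pos 2]

/-! ## The carrier-agnostic bookkeeping -/

/-- **Renormalisation bound ⇒ dissipation rate on every length-scale class, for an arbitrary carrier.** For
`α > 0`, a `C⁰_t C^{0,α}_x` carrier `b` weakly divergence free at every time, viscosities `ν_j > 0`, and the
renormalisation-type decay hypothesis (for every class `R`: a fraction `η(R) > 0` of the energy of every A0 weak
solution from an `H¹` mean-zero divergence-free datum of class `R` is gone for a.e. `t ∈ (½,1)`, uniformly in
`j ≥ j₀(R)`): for every `R` there is `c(R) > 0` such that, for every `j` and every admissible datum of class `R`, an A0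
weak solution along `(ν_j, b)` exists (`CascadeBookkeeping.stub_existence`, Lions) and EVERY weak solution has
`c(R)‖w₀‖² ≤ ν_j∫₀¹‖∇w‖²` — with `c(R) = min (η'/2) (4π²m/(1+8π²m))`, from the lower energy inequality
`CascadeBookkeeping.stub_lowerEnergy` and, for `j < j₀(R)`, Poincaré decay of mean-zero slices.
[cite: ArmstrongVicol2025, Thm. 1.1 (shape of the conclusion: energy fraction dissipated by time 1)] -/
theorem rate_of_renormalisationBound {α : ℝ≥0} (hα : 0 < α)
    {b : ℝ → UnitAddTorus (Fin 3) → EuclideanSpace ℝ (Fin 3)} (hHolder : ContinuousInHolderOn univ α b)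
    (hdiv : ∀ t, IsWeaklyDivFree (b t)) {ν : ℕ → ℝ} (hν : ∀ j, 0 < ν j)
    (hRB : ∀ R : ℝ≥0, ∃ η > (0:ℝ), ∃ j₀ : ℕ, ∀ j ≥ j₀, ∀ w₀ : UnitAddTorus (Fin 3) → EuclideanSpace ℝ (Fin 3),
      MemSobolev 1 (EuclideanSpace.complexify ∘ w₀) → HasZeroMean w₀ → IsWeaklyDivFree w₀ →
      eGradNormSq w₀ ≤ (R : ℝ≥0∞) * ENNReal.ofReal (vectorL2Sq w₀) →
      ∀ w, IsWeakPassiveVectorOn 0 1 (ν j) b w₀ w →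
        ∀ᵐ t ∂(volume.restrict (Ioo (1/2 : ℝ) 1)), ∫ x, ‖w t x‖ ^ 2 ≤ (1 - η) * ∫ x, ‖w₀ x‖ ^ 2)
    (R : ℝ≥0) :
    ∃ c : ℝ, 0 < c ∧ ∀ j, ∀ w₀ : UnitAddTorus (Fin 3) → EuclideanSpace ℝ (Fin 3),
      MemSobolev 1 (EuclideanSpace.complexify ∘ w₀) → HasZeroMean w₀ → IsWeaklyDivFree w₀ →
      eGradNormSq w₀ ≤ (R : ℝ≥0∞) * ENNReal.ofReal (vectorL2Sq w₀) →
      (∃ w, IsWeakPassiveVectorOn 0 1 (ν j) b w₀ w) ∧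
        ∀ w : ℝ → UnitAddTorus (Fin 3) → EuclideanSpace ℝ (Fin 3), IsWeakPassiveVectorOn 0 1 (ν j) b w₀ w →
          ENNReal.ofReal (c * vectorL2Sq w₀) ≤ eVectorDissipation (ν j) w 0 1 := by
  obtain ⟨η, hη, j₀, hj₀⟩ := hRB R
  obtain ⟨m, hm, hmle⟩ := exists_pos_forall_lt_le ν hν j₀
  have hη' : 0 < min η 1 := lt_min hη one_pos
  refine ⟨min (min η 1 / 2) (4 * Real.pi ^ 2 * m / (1 + 8 * Real.pi ^ 2 * m)), lt_min (by positivity) (by positivity),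
    fun j w₀ hH1 h0 hdf hRw₀ => ?_⟩
  have hbtop := memLp_top_stLift_of_continuousInHolderOn hα hHolder 1
  have hw₀2 : MemLp w₀ 2 volume := memLp_two_of_memSobolev_complexify zero_le_one hH1
  -- (V1) A0 weak existence: J.-L. Lions' method (`PassiveVectorLionsExistence`; = `CascadeBookkeeping.stub_existence`)
  refine ⟨exists_isWeakPassiveVectorOn one_pos (hν j) hbtop (ae_of_all _ fun t => hdiv t) hw₀2 hdf, fun w hw => ?_⟩
  -- (V2) the lower energy inequality: energy equality (`PassiveVectorEnergyEquality`; = `CascadeBookkeeping.stub_lowerEnergy`)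
  have hE := hw.ae_lower_energy_ineq (hν j) hw₀2 hdf hbtop
  have hA : 0 ≤ vectorL2Sq w₀ := integral_nonneg fun _ => sq_nonneg _
  by_cases hj : j₀ ≤ j
  · -- renormalisation bound + lower energy inequality
    have hd := hj₀ j hj w₀ hH1 h0 hdf hRw₀ w hw
    have hd' : ∀ᵐ t ∂(volume.restrict (Ioo (1/2 : ℝ) 1)), vectorL2Sq (w t) ≤ (1 - min η 1) * vectorL2Sq w₀ := by
      filter_upwards [hd] with t ht
      exact ht.trans (mul_le_mul_of_nonneg_right (by linarith [min_le_left η 1]) hA)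
    have key := dissipation_ge_of_decay hη' (min_le_right _ _) hA hd' hE
    exact le_trans (ENNReal.ofReal_le_ofReal (mul_le_mul_of_nonneg_right (min_le_left _ _) hA)) key
  · -- Poincaré decay at the finitely many `j < j₀`
    rw [not_le] at hj
    have key := dissipation_ge_of_hasZeroMean (hν j) hw.ae_memLp_two
      (ae_hasZeroMean hw (hw₀2.integrable one_le_two) h0) hE
    have hg := poincareConst_mono hm (hmle j hj)
    exact le_trans (ENNReal.ofReal_le_ofReal (mul_le_mul_of_nonneg_right ((min_le_right _ _).trans hg) hA)) key

/-- **Renormalisation bound ⇒ rung leaf, for an arbitrary carrier.** For `α > 0`, a time-periodic `C⁰_t C^{0,α}_x`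
carrier `b` weakly divergence free at every time, viscosities `ν_j > 0` with `ν_j → 0`, and the renormalisation-type
decay hypothesis of `rate_of_renormalisationBound`, the witnesses `(α, b, ν)` satisfy the rung leaf — stated here as the
LITERAL body of `Summit.AnomalousDissipation.AnomalousDissipation.Theses.SolenoidalFractalHomogenisation.Target` (this
file does not import the route file; `exact leaf_of_renormalisationBound …` closes `Target` by unfolding).
[cite: ArmstrongVicol2025, Thm. 1.1 (shape of the conclusion: energy fraction dissipated by time 1)] -/
theorem leaf_of_renormalisationBound {α : ℝ≥0} (hα : 0 < α)
    {b : ℝ → UnitAddTorus (Fin 3) → EuclideanSpace ℝ (Fin 3)}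
    (hper : ∃ τ : ℝ, 0 < τ ∧ Function.Periodic b τ) (hHolder : ContinuousInHolderOn univ α b)
    (hdiv : ∀ t, IsWeaklyDivFree (b t)) {ν : ℕ → ℝ} (hν : ∀ j, 0 < ν j) (hν0 : Tendsto ν atTop (𝓝 0))
    (hRB : ∀ R : ℝ≥0, ∃ η > (0:ℝ), ∃ j₀ : ℕ, ∀ j ≥ j₀, ∀ w₀ : UnitAddTorus (Fin 3) → EuclideanSpace ℝ (Fin 3),
      MemSobolev 1 (EuclideanSpace.complexify ∘ w₀) → HasZeroMean w₀ → IsWeaklyDivFree w₀ →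
      eGradNormSq w₀ ≤ (R : ℝ≥0∞) * ENNReal.ofReal (vectorL2Sq w₀) →
      ∀ w, IsWeakPassiveVectorOn 0 1 (ν j) b w₀ w →
        ∀ᵐ t ∂(volume.restrict (Ioo (1/2 : ℝ) 1)), ∫ x, ‖w t x‖ ^ 2 ≤ (1 - η) * ∫ x, ‖w₀ x‖ ^ 2) :
    ∃ α : NNReal, 0 < α ∧ ∃ b : ℝ → UnitAddTorus (Fin 3) → EuclideanSpace ℝ (Fin 3), (∃ τ : ℝ, 0 < τ ∧ Function.Periodic b τ) ∧
      ContinuousInHolderOn Set.univ α b ∧ (∀ t, IsWeaklyDivFree (b t)) ∧ ∃ ν : ℕ → ℝ, (∀ j, 0 < ν j) ∧ Tendsto ν atTop (nhds 0) ∧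
      ∀ R : NNReal, ∃ c : ℝ, 0 < c ∧ ∀ j, ∀ w₀ : UnitAddTorus (Fin 3) → EuclideanSpace ℝ (Fin 3),
        MemSobolev 1 (EuclideanSpace.complexify ∘ w₀) → HasZeroMean w₀ → IsWeaklyDivFree w₀ →
        eGradNormSq w₀ ≤ (R : ENNReal) * ENNReal.ofReal (vectorL2Sq w₀) → (∃ w, IsWeakPassiveVectorOn 0 1 (ν j) b w₀ w) ∧
          ∀ w : ℝ → UnitAddTorus (Fin 3) → EuclideanSpace ℝ (Fin 3), IsWeakPassiveVectorOn 0 1 (ν j) b w₀ w →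
            ENNReal.ofReal (c * vectorL2Sq w₀) ≤ eVectorDissipation (ν j) w 0 1 :=
  ⟨α, hα, b, hper, hHolder, hdiv, ν, hν, hν0, rate_of_renormalisationBound hα hHolder hdiv hν hRB⟩

/-! ## Instances: the Eulerian fractal carrier and the Lagrangian lattice carrier -/

/-- **The Eulerian fractal-carrier instance.** For `D : FractalCarrierData k`, `Regular`, the renormalisation bound
and `kbar_j → 0` (the only clause of `Permissible` the bookkeeping uses) give the leaf (the body of the route's
`Target`): the instantiation `b := D.carrier`, `ν := D.kbar` of `leaf_of_renormalisationBound` — so the route's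
`CascadeBookkeeping` holds with `Permissible` weakened to its last clause.
[cite: ArmstrongVicol2025, Thm. 1.1 (shape of the conclusion)] -/
theorem leaf_of_fractalCarrierData {k : ℕ} (D : FractalCarrierData k) (hkbar : Tendsto D.kbar atTop (𝓝 0))
    (hR : D.Regular) (hRB : D.RenormalisationBound) :
    ∃ α : NNReal, 0 < α ∧ ∃ b : ℝ → UnitAddTorus (Fin 3) → EuclideanSpace ℝ (Fin 3), (∃ τ : ℝ, 0 < τ ∧ Function.Periodic b τ) ∧
      ContinuousInHolderOn Set.univ α b ∧ (∀ t, IsWeaklyDivFree (b t)) ∧ ∃ ν : ℕ → ℝ, (∀ j, 0 < ν j) ∧ Tendsto ν atTop (nhds 0) ∧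
      ∀ R : NNReal, ∃ c : ℝ, 0 < c ∧ ∀ j, ∀ w₀ : UnitAddTorus (Fin 3) → EuclideanSpace ℝ (Fin 3),
        MemSobolev 1 (EuclideanSpace.complexify ∘ w₀) → HasZeroMean w₀ → IsWeaklyDivFree w₀ →
        eGradNormSq w₀ ≤ (R : ENNReal) * ENNReal.ofReal (vectorL2Sq w₀) → (∃ w, IsWeakPassiveVectorOn 0 1 (ν j) b w₀ w) ∧
          ∀ w : ℝ → UnitAddTorus (Fin 3) → EuclideanSpace ℝ (Fin 3), IsWeakPassiveVectorOn 0 1 (ν j) b w₀ w →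
            ENNReal.ofReal (c * vectorL2Sq w₀) ≤ eVectorDissipation (ν j) w 0 1 := by
  obtain ⟨-, α, hα, hHolder, hper, hdiv⟩ := hR
  exact leaf_of_renormalisationBound hα hper hHolder hdiv D.kbar_pos hkbar hRB

/-- **The Lagrangian lattice-carrier instance** (Armstrong–Vicol's Lagrangian insertion, `LagrangianLatticeCarrier`):
`LPermissible` (through `kbar_j → 0` of the underlying `Permissible` only), `Regular` and `RenormalisationBound` of
`E : LagrangianLatticeCarrier k` give the leaf with `b := E.carrier`, `ν := E.kbar` — the bookkeeping support
"`LPermissible → Regular → RenormalisationBound → Target`" of the Lagrangian re-typing, as one term.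
[cite: ArmstrongVicol2025, Thm. 1.1 (shape of the conclusion)] -/
theorem leaf_of_lagrangianLatticeCarrier {k : ℕ} (E : LagrangianLatticeCarrier k) (hP : E.LPermissible)
    (hR : E.Regular) (hRB : E.RenormalisationBound) :
    ∃ α : NNReal, 0 < α ∧ ∃ b : ℝ → UnitAddTorus (Fin 3) → EuclideanSpace ℝ (Fin 3), (∃ τ : ℝ, 0 < τ ∧ Function.Periodic b τ) ∧
      ContinuousInHolderOn Set.univ α b ∧ (∀ t, IsWeaklyDivFree (b t)) ∧ ∃ ν : ℕ → ℝ, (∀ j, 0 < ν j) ∧ Tendsto ν atTop (nhds 0) ∧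
      ∀ R : NNReal, ∃ c : ℝ, 0 < c ∧ ∀ j, ∀ w₀ : UnitAddTorus (Fin 3) → EuclideanSpace ℝ (Fin 3),
        MemSobolev 1 (EuclideanSpace.complexify ∘ w₀) → HasZeroMean w₀ → IsWeaklyDivFree w₀ →
        eGradNormSq w₀ ≤ (R : ENNReal) * ENNReal.ofReal (vectorL2Sq w₀) → (∃ w, IsWeakPassiveVectorOn 0 1 (ν j) b w₀ w) ∧
          ∀ w : ℝ → UnitAddTorus (Fin 3) → EuclideanSpace ℝ (Fin 3), IsWeakPassiveVectorOn 0 1 (ν j) b w₀ w →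
            ENNReal.ofReal (c * vectorL2Sq w₀) ≤ eVectorDissipation (ν j) w 0 1 := by
  obtain ⟨-, α, hα, hHolder, hper, hdiv⟩ := hR
  have hkbar : Tendsto E.kbar atTop (𝓝 0) := hP.permissible.2.2.2.2.2.2.2.2
  exact leaf_of_renormalisationBound hα hper hHolder hdiv E.kbar_pos hkbar hRB

end Summit.AnomalousDissipation.AnomalousDissipation.Theorems.SolenoidalFractalHomogenisation.CascadeBookkeepingCore

end
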